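import Literature.AlgebraicGeometry.HodgeTheory.HodgeSheafWedge
import Literature.AlgebraicGeometry.HodgeTheory.AtiyahClass
import Literature.AlgebraicGeometry.HodgeTheory.TwistedSemiregularityMap
import Literature.AlgebraicGeometry.Deformation.SquareZeroExtensionObstruction
import HarnessLib

/-!
# Bloch's semiregularity pairing and Bloch semiregularity of a closed subscheme (real carriers)

Layer `Literature/AlgebraicGeometry/HodgeTheory`; the REAL-carrier counterpart of the abstract
`SubspaceAtiyahTraceAlgebra.blochSemiregularityMap` / `SubschemeSemiregularityData` of
`HodgeTheory/SemiregularityMap.lean` (hypothesis structures). Requested by `defn-BlochSemiregularityMap`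
(crux `VariationalHodge`, line `polar-patch-broken-cycles`: Bloch semiregularity of a polar-patched
broken cycle `W` — a local complete intersection SURFACE in a FOURFOLD — "on real carriers, not as a
hypothesis structure").

## Sources, verbatim

* [BuchweitzFlenner2003] R.-O. Buchweitz, H. Flenner, *A semiregularity map for modules and applications
  to deformations*, Compositio Math. 137 (2003) (arXiv:math/9912245, held; read pp. 3, 38–40). §1 (p.
  3): "Severi … introduced the notion of a semiregular curve on a surface to mean that the restriction
  map `H⁰(X, ω_X) → H⁰(Z, ω_X|Z)` is surjective or, dually, that the semiregularity map `H¹(Z, 𝒩_{Z/X})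
  → H²(X, 𝒪_X)` is injective … This result was extended to divisors in arbitrary projective complex
  manifolds by Kodaira and Spencer. In 1972, S. Bloch was able to define more generally for every
  locally complete intersection `Z` of codimension `q` in `X` a semiregularity map `τ : H¹(Z, 𝒩_{Z/X}) →
  H^{q+1}(X, Ω^{q-1}_X)` to show again that the injectivity of `τ` implies that `[Z]` is a smooth point
  of `H_X`. His semiregularity map admits a simple description using Serre duality." §8, (8.1) (p. 38):
  "`X` is a compact complex manifold and `Z ⊆ X` is a locally complete intersection of (constant)
  codimension `q` with ideal sheaf `𝒥 ⊆ 𝒪_X` … for a locally complete intersection `T^k_{Z/X}(𝒪_Z) ≅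
  H^{k-1}(Z, 𝒩_{Z/X})` for all `k`, where `𝒩_{Z/X} ≅ (𝒥/𝒥²)^∨ := 𝓗om_{𝒪_Z}(𝒥/𝒥², 𝒪_Z)` is the normal
  bundle of `Z` in `X`. Bloch's semiregularity map is constructed as follows. With `m := dim Z`, there
  is a natural pairing `Ω^{m+1}_X × Λ^{q-1}𝒩^∨_{Z/X} → Ω^{m+1}_X × Ω^{q-1}_X ⊗ 𝒪_Z → ω_X ⊗ 𝒪_Z` (`1 ×
  Λ^{q-1}d̄`, then `∧`), where `d̄ : 𝒩^∨_{Z/X} ≅ 𝒥/𝒥² → Ω¹_X ⊗ 𝒪_Z` is the map induced by the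
  differential `d : 𝒥 → Ω¹_X`. Equivalently, this amounts to a map (1) `Ω^{m+1}_X → Λ^{q-1}𝒩_{Z/X} ⊗ ω_X
  ≅ 𝒩^∨_{Z/X} ⊗ ω_Z`, where we have used the adjunction formula `ω_Z ≅ det 𝒩_{Z/X} ⊗ ω_X` and the
  isomorphism `Λ^{q-1}𝒩_{Z/X} ≅ 𝒩^∨_{Z/X} ⊗ det 𝒩_{Z/X}`. Dualizing the induced map in cohomology
  `H^{m-k}(X, Ω^{m+1}_X) → H^{m-k}(Z, 𝒩^∨_{Z/X} ⊗ ω_Z)` gives a map (2) `τ_B : H^k(Z, 𝒩_{Z/X}) →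
  H^{q+k}(X, Ω^{q-1}_X)`, and Bloch's semiregularity map is just this map for `k = 1`." Prop. 8.2: "The
  maps `τ_B` and `τ` coincide" (`τ = σ_{q-1} ∘ ε²` of Def. 4.10).
* [Bloch1972Semiregularity] S. Bloch, *Semi-regularity and de Rham cohomology*, Invent. Math. 17 (1972)
  (not held — cite-only, acq-01573; its definition of `π : H¹(Z, 𝒩) → H^{p+1}(X, Ω^{p-1})` and the
  duality description are quoted from BF above).
* [BandieraLepriManetti2023] R. Bandiera, E. Lepri, M. Manetti, Adv. Math. 435 (2023), §1: "`Z` is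
  semiregular if and only if the semiregularity map is injective"; "Bloch was able to define a
  semiregularity map `σ : H¹(Z, N_{Z|X}) → H^{p+1}(X, Ω^{p-1}_X)`".
* [Hartshorne1977] II.8 (Kähler differentials, `d(ab) = a db + b da`; the conormal sequence II.8.12 /
  8.17: `𝒥/𝒥² → Ω_{X}|_Z`, `f ↦ df`), II.5 (p. 110: `f^*` is left adjoint to `f_*`; sheaf Hom), III
  Ex. 4.1 / Ex. 8.1 (`Hⁱ(X, f_*ℱ) = Hⁱ(Z, ℱ)` for `f` affine), III Thm. 7.6, Cor. 7.7, Thm. 7.11 (Serre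
  duality on a Cohen–Macaulay projective scheme; `ω_Z ≅ ω_X ⊗ Λ^q 𝒩` for a local complete intersection).

## What is defined (everything REAL: `def`s with bodies and proved lemmas; no hypothesis structures,
## no named facts)

Mathlib (pin v4.32) and the tree have neither Serre duality, nor dualizing sheaves, nor local cohomology
of coherent sheaves, nor the trace of a perfect complex such as `𝒪_Z` (the tree's Atiyah class `At(E) ∈
Ext¹(E, 𝓗om(E^∨, Ω¹))` is the zero map for a torsion sheaf `E = 𝒪_Z`), so neither BF's `σ_{q-1} ∘ ε²`
nor the literal transpose `τ_B` of (8.1) (2) can be written today. What CAN be written, exactly as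
printed, is the map that BF dualize: the pairing (8.1) (1) and "the induced map in cohomology". This
file constructs it on real carriers and DEFINES Bloch semiregularity through it — for `q = 1` this is
literally Severi's definition quoted above ("the restriction map `H⁰(X, ω_X) → H⁰(Z, ω_X|Z)` is
surjective or, DUALLY, … injective"), and for general `q` it is the transpose of Bloch's map by BF's
very definition (2) of `τ_B`, so that on a smooth proper `X` over a field (finite-dimensional
cohomology, Serre duality on `X` and on the Cohen–Macaulay `Z`) SURJECTIVITY of the map below in degree
`m - 1` is INJECTIVITY of `π_Z = τ_B : H¹(Z, 𝒩_{Z/X}) → H^{q+1}(X, Ω^{q-1}_X)`.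

Everything is written on `X` with `𝒪_X`-modules (no pull-back of the conormal sheaf is needed): for `i :
Z ⟶ X` (intended: a closed immersion) with ideal `𝓘 = Ker(𝒪_X → i_*𝒪_Z)` (`Deformation.idealModule`,
real) and `Ωⁿ_X|_Z := i_* i^* Ωⁿ_{X/S}` (`formsOnSubscheme`, Mathlib's `pullback`/`pushforward` and the
unit of `i^* ⊣ i_*`):

* `IsKilledBySections`, `isKilledBySections_pushforward` — sections of `𝓘` act by zero on every `i_*M`
  (`i♯` vanishes on `𝓘`), hence on `𝓗om(𝓘, … 𝓗om(𝓘, i_*M))` (`multiHom`, `IsKilledBySections.multiHom`);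
* `dIdeal a = d(ι a) ∈ Γ(Ω¹)` for a section `a` of `𝓘` (the tree's `dSection`), with Leibniz `d(ι(fa)) =
  f d(ιa) + ι(a) df` — the second term dies on anything killed by `𝓘`: this is WHY the pairing below is
  `𝒪_X`-linear in the conormal slots, i.e. why `d̄ : 𝒥/𝒥² → Ω¹_X ⊗ 𝒪_Z` is linear;
* `stepHom ψ : Ωʲ → 𝓗om(𝓘, M')`, `α ↦ (a ↦ ψ(d(ιa) ∧ α))` for `ψ : Ωʲ⁺¹ → M'` with `M'` killed by `𝓘`
  (built on the tree's sheaf wedge `wedgeSheafHom : Ωʲ → 𝓗om(Ω¹, Ωʲ⁺¹)` of `HodgeSheafWedge.lean`);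
* **`blochPairingSheafHom i r j : Ωʲ_X → 𝓗om(𝓘, 𝓗om(𝓘, …, 𝓗om(𝓘, Ω^{j+r}_X|_Z)…))`** (`r` slots), by
  recursion (`r = 0`: restriction of forms to `Z`): the curried form of BF's pairing `Ω^{m+1}_X ×
  Λ^{q-1}𝒩^∨ → ω_X ⊗ 𝒪_Z`, `(α, ν₁ ∧ ⋯ ∧ ν_{q-1}) ↦ α ∧ d̄ν₁ ∧ ⋯ ∧ d̄ν_{q-1}` for `j = m + 1`, `r = q -
  1`, `j + r = n = dim X` (our order of factors is `d̄ν ∧ ⋯ ∧ α`, a sign `(−1)^{(m+1)(q-1)}` away from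
  BF's, irrelevant for kernels and images); `evalMulti_blochPairingSheafHom_app` computes its values on
  (images of) honest exterior-power forms `ω ∈ Λʲ Γ(U, Ω¹)`: `ρ(ω)(a₀, …, a_{r-1}) = (dι(a₀) ∧ ⋯ ∧
  dι(a_{r-1}) ∧ ω)|_Z` (`wedgeIter`, `coe_wedgeIter`: the product `ι(θ₀)⋯ι(θ_{r-1})·ω` in the exterior
  algebra), hence ALTERNATING in the `a`'s (`isAltSection_blochPairingSheafHom_app`, from
  `ExteriorAlgebra.ιMulti_eq_zero_of_not_inj`);
* `altMultiHom 𝓘 T r ⊆ multiHom 𝓘 T r` — the subsheaf of ALTERNATING iterated homomorphisms (a sheaf: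
  the condition is local; Mathlib `PresheafOfModules.Submodule`), i.e. `𝓗om_{𝒪_X}(Λʳ𝓘, T)`; for `T =
  Ωⁿ_X|_Z` and `Z` a local complete intersection of codimension `q = r + 1` this is `i_*
  𝓗om_{𝒪_Z}(Λ^{q-1}(𝓘/𝓘²), ω_X|_Z) = i_*(Λ^{q-1}𝒩_{Z/X} ⊗ ω_X|_Z) ≅ i_*(𝒩^∨_{Z/X} ⊗ ω_Z)`, the TARGET
  SHEAF of (8.1) (1) (`𝓗om_X(F, i_*G) = i_*𝓗om_Z(i^*F, G)`, `i^*Λ = Λ i^*`, alternating maps = maps from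
  `Λ`; and `Hᵏ(X, i_*G) = Hᵏ(Z, G)`, `i` being affine); for `r ≤ 1` it is all of `multiHom`
  (`isIso_altι_of_le_one`);
* **`blochPairingAltSheafHom i r j : Ωʲ_X → 𝓐lt_r(𝓘; Ω^{j+r}_X|_Z)`** — the pairing with values in the
  alternating subsheaf (through the sheafification adjunction, as `wedgeSheafHom` is built), with
  `blochPairingAltSheafHom_comp_altι`;
* **`blochPairingMap i r j k : Hᵏ(X, Ωʲ_X) →+ Hᵏ(X, 𝓐lt_r(𝓘; Ω^{j+r}_X|_Z))`** = BF's "induced map in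
  cohomology `H^{m-k'}(X, Ω^{m+1}_X) → H^{m-k'}(Z, 𝒩^∨ ⊗ ω_Z)`" (`k = m - k'`) on the tree's real
  `Motives.hodgeCohomology` / `moduleSheafCohomology` (Mathlib `Sheaf.H`), whose transpose IS `τ_B :
  H^{k'}(Z, 𝒩) → H^{q+k'}(X, Ω^{q-1})` by (8.1) (2); `blochPairingMapMultiHom` (same, full target);
* **`IsBlochSemiregular i n p`** — `Z` of pure codimension `p` in `X` of pure dimension `n` is
  Bloch-semiregular: for `r + 1 = p`, `m + p = n`, `k + 1 = m` the map `blochPairingMap i r (m+1) k`,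
  `H^{m-1}(X, Ω^{m+1}_X) → H^{m-1}(Z, 𝒩^∨ ⊗ ω_Z)`, is SURJECTIVE (⟺ `π_Z : H¹(Z, 𝒩) → H^{p+1}(X,
  Ω^{p-1})` injective); `isBlochSemiregular_iff`; **`isBlochSemiregular_one_iff`** (hypersurfaces:
  surjectivity of the restriction `H^{n-2}(X, ω_X) → H^{n-2}(Z, ω_X|_Z)` — Severi / Kodaira–Spencer);
  **`isBlochSemiregular_two_iff`** (codimension two, the route's surfaces in fourfolds: surjectivity of
  `H^{m-1}(X, Ω^{m+1}_X) → H^{m-1}(X, 𝓗om(𝓘, Ω^{m+2}_X|_Z)) = H^{m-1}(Z, 𝒩 ⊗ ω_X|_Z)`, `α ↦ (a ↦ da ∧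
  α)`; for `n = 4`: `H¹(X, Ω³_X) → H¹(W, 𝒩_W ⊗ K_X)`); degenerate cases (`p = 0`, `p > n`, `dim Z = 0`)
  are vacuously semiregular, as they are for Bloch;
* `normalSheaf i = (i^*𝓘)^∨` (`Modules.dual` of `Deformation.conormalSheaf`, on `Z`) and
  `normalSheafCohomology i k = Hᵏ(Z, 𝒩_{Z/X})` (`moduleSheafCohomology`) — the printed source `H¹(Z,
  𝒩_{Z/X})` of Bloch's map, as requested.

## Conventions, scope, and what is NOT here

* Generality: any commutative ring `S`, any `S`-scheme `X`, any morphism `i : Z ⟶ X` (the definitions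
  need no hypothesis); the MEANING above requires `X` smooth and proper over a field of pure dimension
  `n`, `i` a closed immersion and `Z` a local complete intersection of pure codimension `p` (BF: compact
  complex manifolds; Bloch: smooth projective over a field of characteristic `0`). TODO(general form):
  `X → Y` relative / `Λ^q 𝕃_{X/Y}` (BF's generality).
* Not here (each a theory the pin lacks): Serre duality and hence the transposed map `τ_B : H¹(Z, 𝒩) →
  H^{q+1}(X, Ω^{q-1}_X)` ITSELF and the proof that `IsBlochSemiregular` is its injectivity; BF Prop. 8.2
  (`τ_B = σ_{q-1} ∘ ε²`) and the local-cohomology description `μ : 𝒩 → 𝓗^q_Z(Ω^{q-1}_X)` of (8.1) (3);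
  the identification `𝓐lt_{q-1}(𝓘; Ωⁿ_X|_Z) ≅ i_*(𝒩^∨ ⊗ ω_Z)` as an isomorphism of sheaves (it is the
  definition-level reading of the target, see above); Bloch's theorem / BF Thm. 5.1–5.2 (semiregular ⟹
  unobstructed where the class stays Hodge), which are the route's separate FACT requests and will take
  `IsBlochSemiregular` as hypothesis.
-/

noncomputable section

open CategoryTheory CategoryTheory.Limits AlgebraicGeometry Opposite TopologicalSpace

universe u

namespace Literature.AlgebraicGeometry.HodgeTheory

open Literature.AlgebraicGeometry.Modules Literature.AlgebraicGeometry.Motives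
  Literature.AlgebraicGeometry.Deformation

/-! ### Sections killing a module -/

section Killed

variable {Y : Scheme.{u}}

/-- A section `a ∈ Γ(I, W)` read in `Γ(W, 𝒪_Y)` through `ιI : I → 𝒪_Y` (a plain function with
values in the ring of sections, so that it can act on sections of any `𝒪_Y`-module). [folklore] -/
def toRing {I : Y.Modules} (ιI : I ⟶ unitModule Y) (W : Y.Opens) (a : Γ(I, W)) : Γ(Y, W) :=
  ιI.app W a

/-- `toRing` is additive. [folklore] -/
theorem toRing_add {I : Y.Modules} (ιI : I ⟶ unitModule Y) (W : Y.Opens) (a b : Γ(I, W)) :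
    toRing ιI W (a + b) = toRing ιI W a + toRing ιI W b :=
  map_add (ιI.app W).hom a b

/-- `toRing 0 = 0`. [folklore] -/
@[simp]
theorem toRing_zero {I : Y.Modules} (ιI : I ⟶ unitModule Y) (W : Y.Opens) :
    toRing ιI W (0 : Γ(I, W)) = 0 :=
  map_zero (ιI.app W).hom

/-- `toRing` is `𝒪(W)`-linear: `ι(f a) = f ι(a)`. [folklore] -/
theorem toRing_smul {I : Y.Modules} (ιI : I ⟶ unitModule Y) (W : Y.Opens) (f : Γ(Y, W))
    (a : Γ(I, W)) : toRing ιI W (f • a) = f * toRing ιI W a :=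
  Scheme.Modules.Hom.app_smul ιI f a

/-- Naturality of `ιI : I → 𝒪_Y` on sections: `ι(a)|_{W'} = ι(a|_{W'})`. [folklore] -/
theorem map_toRing {I : Y.Modules} (ιI : I ⟶ unitModule Y) {W W' : Y.Opens} (k : W' ⟶ W)
    (a : Γ(I, W)) :
    Y.presheaf.map k.op (toRing ιI W a) = toRing ιI W' (I.presheaf.map k.op a) :=
  (PresheafOfModules.naturality_apply ιI.val k.op a).symm

/-- The sections of `I` (read in `𝒪_Y` through `ιI : I → 𝒪_Y`) **kill** the `𝒪_Y`-module `M`: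
`ι(a) • y = 0` for all local sections `a` of `I` and `y` of `M` over the same open. For `I = 𝓘` the
ideal of a closed subscheme `Z` this says that `M` is an `𝒪_Z`-module. [folklore] -/
def IsKilledBySections (I : Y.Modules) (ιI : I ⟶ unitModule Y) (M : Y.Modules) : Prop :=
  ∀ (W : Y.Opens) (a : Γ(I, W)) (y : Γ(M, W)), toRing ιI W a • y = 0

/-- **The iterated internal Hom** `multiHom I T r = 𝓗om(I, 𝓗om(I, … 𝓗om(I, T)…))` (`r` copies of
`I`): its local sections over `U` are the `r`-fold `𝒪`-multilinear maps `I|_U × ⋯ × I|_U → T|_U`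
(curried). [folklore] -/
def multiHom (I T : Y.Modules) : ℕ → Y.Modules
  | 0 => T
  | r + 1 => sheafHom I (multiHom I T r)

/-- `multiHom I T 0 = T`. [folklore] -/
@[simp]
theorem multiHom_zero (I T : Y.Modules) : multiHom I T 0 = T := rfl

/-- `multiHom I T (r + 1) = 𝓗om(I, multiHom I T r)`. [folklore] -/
@[simp]
theorem multiHom_succ (I T : Y.Modules) (r : ℕ) :
    multiHom I T (r + 1) = sheafHom I (multiHom I T r) := rfl

/-- If the sections of `I` kill `M`, they kill `𝓗om(I', M)` for any `I'`:
`(ιI(a) • φ)(s) = ιI(a)| • φ(s) = 0`. [folklore] -/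
theorem IsKilledBySections.sheafHom {I : Y.Modules} {ιI : I ⟶ unitModule Y} {M : Y.Modules}
    (hM : IsKilledBySections I ιI M) (I' : Y.Modules) : IsKilledBySections I ιI (sheafHom I' M) := by
  intro W a y
  refine hom_ext_of_appLE fun W' k s => ?_
  change Y.presheaf.map k.op (toRing ιI W a) • appLE y k s = appLE (0 : I'.over W ⟶ M.over W) k s
  rw [appLE_zero, map_toRing ιI k a]
  exact hM W' _ _

/-- If the sections of `I` kill `T`, they kill every `multiHom I T r`. [folklore] -/
theorem IsKilledBySections.multiHom {I : Y.Modules} {ιI : I ⟶ unitModule Y} {T : Y.Modules}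
    (hT : IsKilledBySections I ιI T) : (r : ℕ) → IsKilledBySections I ιI (multiHom I T r)
  | 0 => hT
  | r + 1 => (IsKilledBySections.multiHom hT r).sheafHom I

end Killed

/-! ### The ideal of a closed subscheme kills direct images -/

section Ideal

variable {Y Z : Scheme.{u}} (i : Z ⟶ Y)

/-- A section `a` of the ideal `𝓘 = Ker(i♯ : 𝒪_Y → i_*𝒪_Z)` restricts to zero on `Z`:
`i♯(a) = 0`. [cite: StacksProject, Tag 08KY] -/
theorem app_idealModuleι_eq_zero (W : Y.Opens) (a : Γ(idealModule i, W)) :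
    i.app W (toRing (idealModuleι i) W a) = 0 := by
  have h := congrArg (fun φ => Scheme.Modules.Hom.app φ W a) (kernel.condition (structureModuleMap i))
  dsimp only at h
  rw [Scheme.Modules.Hom.comp_app, Scheme.Modules.Hom.zero_app] at h
  exact h

/-- **The ideal of `Z` kills every direct image `i_*M`**: `Γ(W, i_*M) = Γ(i⁻¹W, M)` is a module over
`Γ(W, 𝒪_Y)` through `i♯`, and `i♯` vanishes on `𝓘`. [folklore] -/
theorem isKilledBySections_pushforward (M : Z.Modules) :
    IsKilledBySections (idealModule i) (idealModuleι i) ((Scheme.Modules.pushforward i).obj M) := by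
  intro W a y
  change i.app W (toRing (idealModuleι i) W a) • (show Γ(M, i ⁻¹ᵁ W) from y) =
    (0 : Γ(M, i ⁻¹ᵁ W))
  rw [app_idealModuleι_eq_zero, zero_smul]

end Ideal

/-! ### The differential of a section of the ideal -/

section DIdeal

variable {S : Type u} [CommRing S] {X : Over (Spec (CommRingCat.of S))}
  (I : X.left.Modules) (ιI : I ⟶ unitModule X.left) {W W' : X.left.Opens}

/-- `d(ιI a) ∈ Γ(Ω¹_{X/S}, W)` for a section `a` of `I` over `W` (for `I = 𝓘` the ideal of `Z ⊆ X`: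
the differential `d : 𝓘 → Ω¹_X` of BF (8.1), before reduction modulo `𝓘`).
[cite: BuchweitzFlenner2003, (8.1) (the map d-bar induced by d : J → Ω¹_X)] -/
def dIdeal (W : X.left.Opens) (a : Γ(I, W)) : Γ(cotangentSheaf X, W) :=
  dSection X W (toRing ιI W a)

/-- `dIdeal` is additive. [folklore] -/
theorem dIdeal_add (a b : Γ(I, W)) : dIdeal I ιI W (a + b) = dIdeal I ιI W a + dIdeal I ιI W b := by
  rw [dIdeal, dIdeal, dIdeal, toRing_add]
  exact dSection_add _ _

/-- `dIdeal 0 = 0`. [folklore] -/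
@[simp]
theorem dIdeal_zero : dIdeal I ιI W (0 : Γ(I, W)) = 0 := by
  rw [dIdeal, toRing_zero]
  exact dSection_zero

/-- **Leibniz for `dIdeal`**: `d(ι(f a)) = f d(ι a) + ι(a) df`. [cite: Hartshorne1977, II.8 (p. 172)] -/
theorem dIdeal_smul (f : Γ(X.left, W)) (a : Γ(I, W)) :
    dIdeal I ιI W (f • a) = f • dIdeal I ιI W a + toRing ιI W a • dSection X W f := by
  rw [dIdeal, dIdeal, toRing_smul]
  exact dSection_mul f _

/-- `dIdeal` commutes with restriction. [folklore] -/
theorem map_dIdeal (k : W' ⟶ W) (a : Γ(I, W)) :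
    (cotangentSheaf X).presheaf.map k.op (dIdeal I ιI W a) = dIdeal I ιI W' (I.presheaf.map k.op a) := by
  rw [dIdeal, dIdeal, map_dSection, map_toRing ιI k a]

end DIdeal

/-! ### One step of the pairing: `α ↦ (a ↦ ψ(d(ι a) ∧ α))` -/

section Step

variable {S : Type u} [CommRing S] {X : Over (Spec (CommRingCat.of S))}
  (I : X.left.Modules) (ιI : I ⟶ unitModule X.left) {j : ℕ} {M' : X.left.Modules}
  (ψ : hodgeSheaf X (j + 1) ⟶ M')

/-- The wedge `θ ↦ θ ∧ α` with a section `α ∈ Γ(Ωʲ, U)`, as a morphism `Ω¹|_U → Ωʲ⁺¹|_U` (the section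
of `𝓗om(Ω¹, Ωʲ⁺¹)` over `U` that is the value of the tree's `wedgeSheafHom` at `α`). [folklore] -/
def wedgeWith (U : X.left.Opens) (α : Γ(hodgeSheaf X j, U)) :
    (cotangentSheaf X).over U ⟶ (hodgeSheaf X (j + 1)).over U :=
  sheafHomSectionsEquiv (cotangentSheaf X) (hodgeSheaf X (j + 1)) U ((wedgeSheafHom X j).app U α)

/-- `wedgeWith` is additive in `α`. [folklore] -/
theorem wedgeWith_add (U : X.left.Opens) (α β : Γ(hodgeSheaf X j, U)) :
    wedgeWith (X := X) U (α + β) = wedgeWith U α + wedgeWith U β :=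
  map_add ((wedgeSheafHom X j).app U).hom α β

/-- `wedgeWith U 0 = 0`. [folklore] -/
@[simp]
theorem wedgeWith_zero (U : X.left.Opens) : wedgeWith (X := X) (j := j) U 0 = 0 :=
  map_zero ((wedgeSheafHom X j).app U).hom

/-- `wedgeWith` is `𝒪(U)`-linear in `α`. [folklore] -/
theorem wedgeWith_smul (U : X.left.Opens) (f : Γ(X.left, U)) (α : Γ(hodgeSheaf X j, U)) :
    wedgeWith (X := X) U (f • α) = f • wedgeWith U α :=
  Scheme.Modules.Hom.app_smul (wedgeSheafHom X j) f α

/-- `wedgeWith` commutes with restriction: `(∧ α)|_V = ∧ (α|_V)`. [folklore] -/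
theorem restrictHom_wedgeWith {U V : X.left.Opens} (l : V ⟶ U) (α : Γ(hodgeSheaf X j, U)) :
    restrictHom l (wedgeWith U α) = wedgeWith V ((hodgeSheaf X j).presheaf.map l.op α) :=
  (PresheafOfModules.naturality_apply (wedgeSheafHom X j).val l.op α).symm

variable {U W W' : X.left.Opens}

/-- The value `ψ(d(ι a) ∧ α|_W) ∈ Γ(M', W)` of the step on `a ∈ Γ(I, W)`, `W ≤ U`. [folklore] -/
def stepVal (α : Γ(hodgeSheaf X j, U)) (k : W ⟶ U) (a : Γ(I, W)) : Γ(M', W) :=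
  ψ.app W (appLE (wedgeWith U α) k (dIdeal I ιI W a))

/-- `stepVal` is additive in `a`. [folklore] -/
theorem stepVal_add (α : Γ(hodgeSheaf X j, U)) (k : W ⟶ U) (a b : Γ(I, W)) :
    stepVal I ιI ψ α k (a + b) = stepVal I ιI ψ α k a + stepVal I ιI ψ α k b := by
  rw [stepVal, stepVal, stepVal, dIdeal_add, appLE_add_right, map_add]

/-- `stepVal` vanishes at `a = 0`. [folklore] -/
@[simp]
theorem stepVal_zero (α : Γ(hodgeSheaf X j, U)) (k : W ⟶ U) :
    stepVal I ιI ψ α k (0 : Γ(I, W)) = 0 := by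
  rw [stepVal, dIdeal_zero, appLE_zero_right, map_zero]

/-- **`stepVal` is `𝒪(W)`-linear in `a` as soon as the sections of `I` kill `M'`**: by Leibniz,
`ψ(d(ι(fa)) ∧ α) = f ψ(d(ι a) ∧ α) + ι(a) ψ(df ∧ α)` and the last term vanishes. [folklore] -/
theorem stepVal_smul (hM' : IsKilledBySections I ιI M') (α : Γ(hodgeSheaf X j, U)) (k : W ⟶ U)
    (f : Γ(X.left, W)) (a : Γ(I, W)) :
    stepVal I ιI ψ α k (f • a) = f • stepVal I ιI ψ α k a := by
  rw [stepVal, stepVal, dIdeal_smul, appLE_add_right, appLE_smul_right, appLE_smul_right, map_add,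
    Scheme.Modules.Hom.app_smul, Scheme.Modules.Hom.app_smul, hM' W a, add_zero]

/-- **Naturality of `stepVal` in `W`.** [folklore] -/
theorem map_stepVal (α : Γ(hodgeSheaf X j, U)) (k : W ⟶ U) (l : W' ⟶ W) (a : Γ(I, W)) :
    M'.presheaf.map l.op (stepVal I ιI ψ α k a) =
      stepVal I ιI ψ α (l ≫ k) (I.presheaf.map l.op a) := by
  rw [stepVal, stepVal, ← map_dIdeal, appLE_map]
  exact (PresheafOfModules.naturality_apply ψ.val l.op _).symm

/-- `stepVal` is additive in `α`. [folklore] -/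
theorem stepVal_add_left (α β : Γ(hodgeSheaf X j, U)) (k : W ⟶ U) (a : Γ(I, W)) :
    stepVal I ιI ψ (α + β) k a = stepVal I ιI ψ α k a + stepVal I ιI ψ β k a := by
  rw [stepVal, stepVal, stepVal, wedgeWith_add, appLE_add, map_add]

/-- `stepVal` is `𝒪(U)`-linear in `α`. [folklore] -/
theorem stepVal_smul_left (f : Γ(X.left, U)) (α : Γ(hodgeSheaf X j, U)) (k : W ⟶ U) (a : Γ(I, W)) :
    stepVal I ιI ψ (f • α) k a = X.left.presheaf.map k.op f • stepVal I ιI ψ α k a := by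
  rw [stepVal, stepVal, wedgeWith_smul, appLE_smul, Scheme.Modules.Hom.app_smul]

/-- `stepVal` only depends on `α|_W`. [folklore] -/
theorem stepVal_map_left {V : X.left.Opens} (α : Γ(hodgeSheaf X j, U)) (l : V ⟶ U) (k : W ⟶ V)
    (a : Γ(I, W)) :
    stepVal I ιI ψ ((hodgeSheaf X j).presheaf.map l.op α) k a = stepVal I ιI ψ α (k ≫ l) a := by
  rw [stepVal, stepVal, ← restrictHom_wedgeWith, appLE_restrictHom]

variable (hM' : IsKilledBySections I ιI M')

/-- **The step over `U`**: for `α ∈ Γ(Ωʲ, U)` the morphism `I|_U → M'|_U`, `a ↦ ψ(d(ι a) ∧ α)` (a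
section of `𝓗om(I, M')` over `U`). [folklore] -/
def stepOver (U : X.left.Opens) (α : Γ(hodgeSheaf X j, U)) : I.over U ⟶ M'.over U where
  val := PresheafOfModules.homMk
    { app := fun V => AddCommGrpCat.ofHom
        { toFun := fun (a : Γ(I, V.unop.left)) => stepVal I ιI ψ α V.unop.hom a
          map_zero' := stepVal_zero I ιI ψ α V.unop.hom
          map_add' := stepVal_add I ιI ψ α V.unop.hom }
      naturality := fun {V V'} g => by
        refine AddCommGrpCat.ext fun (a : Γ(I, V.unop.left)) => ?_
        change stepVal I ιI ψ α V'.unop.hom (I.presheaf.map g.unop.left.op a) =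
          M'.presheaf.map g.unop.left.op (stepVal I ιI ψ α V.unop.hom a)
        rw [map_stepVal, Over.w] }
    (fun V (f : Γ(X.left, V.unop.left)) (a : Γ(I, V.unop.left)) =>
      stepVal_smul I ιI ψ hM' α V.unop.hom f a)

/-- Values of `stepOver`: `a ↦ ψ(d(ι a) ∧ α|_W)`. [folklore] -/
@[simp]
theorem appLE_stepOver (α : Γ(hodgeSheaf X j, U)) (k : W ⟶ U) (a : Γ(I, W)) :
    appLE (stepOver I ιI ψ hM' U α) k a = stepVal I ιI ψ α k a :=
  rfl

/-- `stepOver` is additive in `α`. [folklore] -/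
theorem stepOver_add (α β : Γ(hodgeSheaf X j, U)) :
    stepOver I ιI ψ hM' U (α + β) = stepOver I ιI ψ hM' U α + stepOver I ιI ψ hM' U β :=
  hom_ext_of_appLE fun W k a => by
    rw [appLE_add, appLE_stepOver, appLE_stepOver, appLE_stepOver, stepVal_add_left]

/-- `stepOver U 0 = 0`. [folklore] -/
@[simp]
theorem stepOver_zero (U : X.left.Opens) :
    stepOver I ιI ψ hM' U (0 : Γ(hodgeSheaf X j, U)) = 0 := by
  have h := stepOver_add I ιI ψ hM' (U := U) 0 0
  rw [add_zero] at h
  exact left_eq_add.mp h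

/-- `stepOver` is `𝒪(U)`-linear in `α`. [folklore] -/
theorem stepOver_smul (f : Γ(X.left, U)) (α : Γ(hodgeSheaf X j, U)) :
    stepOver I ιI ψ hM' U (f • α) = f • stepOver I ιI ψ hM' U α :=
  hom_ext_of_appLE fun W k a => by
    rw [appLE_smul, appLE_stepOver, appLE_stepOver, stepVal_smul_left]

/-- `stepOver` commutes with restriction. [folklore] -/
theorem restrictHom_stepOver {V : X.left.Opens} (l : V ⟶ U) (α : Γ(hodgeSheaf X j, U)) :
    restrictHom l (stepOver I ιI ψ hM' U α) =
      stepOver I ιI ψ hM' V ((hodgeSheaf X j).presheaf.map l.op α) :=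
  hom_ext_of_appLE fun W k a => by
    rw [appLE_restrictHom, appLE_stepOver, appLE_stepOver, stepVal_map_left]

/-- **The step** `Ωʲ → 𝓗om(I, M')`, `α ↦ (a ↦ ψ(d(ι a) ∧ α))`, a morphism of `𝒪_X`-modules (for `M'`
killed by the sections of `I`). [folklore] -/
def stepHom : hodgeSheaf X j ⟶ sheafHom I M' where
  val := PresheafOfModules.homMk
    { app := fun U => AddCommGrpCat.ofHom
        { toFun := fun α : Γ(hodgeSheaf X j, U.unop) =>
            (stepOver I ιI ψ hM' U.unop α : I.over U.unop ⟶ M'.over U.unop)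
          map_zero' := stepOver_zero I ιI ψ hM' U.unop
          map_add' := stepOver_add I ιI ψ hM' }
      naturality := fun {U V} l => by
        refine AddCommGrpCat.ext fun (α : Γ(hodgeSheaf X j, U.unop)) => ?_
        exact (restrictHom_stepOver I ιI ψ hM' l.unop α).symm }
    (fun U (f : Γ(X.left, U.unop)) (α : Γ(hodgeSheaf X j, U.unop)) => stepOver_smul I ιI ψ hM' f α)

/-- Sections of `stepHom`: `α ↦ stepOver U α`. [folklore] -/
@[simp]
theorem stepHom_app_apply (U : X.left.Opens) (α : Γ(hodgeSheaf X j, U)) :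
    (stepHom I ιI ψ hM').app U α = (stepOver I ιI ψ hM' U α : I.over U ⟶ M'.over U) :=
  rfl

end Step

/-! ### Evaluation of iterated Homs on tuples; the alternating subsheaf -/

section Alternating

variable {Y : Scheme.{u}} (I T : Y.Modules)

/-- A section of `multiHom I T (r + 1) = 𝓗om(I, multiHom I T r)` over `U`, as the morphism
`I|_U → (multiHom I T r)|_U` it is (definitional retyping). [folklore] -/
def multiHomSucc (r : ℕ) {U : Y.Opens} (φ : Γ(multiHom I T (r + 1), U)) :
    I.over U ⟶ (multiHom I T r).over U :=
  φ

/-- **Evaluation of a section of `multiHom I T r` on an `r`-tuple of sections of `I`**: for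
`φ ∈ Γ(U, 𝓗om(I, … 𝓗om(I, T)…))`, `k : W ⟶ U` and `a : Fin r → Γ(I, W)`, the section
`φ(a_{r-1})(a_{r-2})⋯(a_0) ∈ Γ(T, W)` (the LAST entry is fed to the outermost `𝓗om`). [folklore] -/
def evalMulti : (r : ℕ) → {U W : Y.Opens} → Γ(multiHom I T r, U) → (W ⟶ U) → (Fin r → Γ(I, W)) →
    Γ(T, W)
  | 0, _, _, φ, k, _ => T.presheaf.map k.op φ
  | r + 1, _, W, φ, k, a =>
    evalMulti r (appLE (multiHomSucc I T r φ) k (a (Fin.last r))) (𝟙 W) (Fin.init a)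

/-- Unfolding `evalMulti` in degree `0`. [folklore] -/
theorem evalMulti_zero {U W : Y.Opens} (φ : Γ(multiHom I T 0, U)) (k : W ⟶ U)
    (a : Fin 0 → Γ(I, W)) : evalMulti I T 0 φ k a = T.presheaf.map k.op φ := rfl

/-- Unfolding `evalMulti` in degree `r + 1`. [folklore] -/
theorem evalMulti_succ (r : ℕ) {U W : Y.Opens} (φ : Γ(multiHom I T (r + 1), U)) (k : W ⟶ U)
    (a : Fin (r + 1) → Γ(I, W)) :
    evalMulti I T (r + 1) φ k a =
      evalMulti I T r (appLE (multiHomSucc I T r φ) k (a (Fin.last r))) (𝟙 W) (Fin.init a) := rfl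

/-- `evalMulti` is additive in `φ`. [folklore] -/
theorem evalMulti_add : (r : ℕ) → {U W : Y.Opens} → (φ ψ : Γ(multiHom I T r, U)) → (k : W ⟶ U) →
    (a : Fin r → Γ(I, W)) →
    evalMulti I T r (φ + ψ) k a = evalMulti I T r φ k a + evalMulti I T r ψ k a
  | 0, _, _, φ, ψ, k, _ => map_add (T.presheaf.map k.op).hom φ ψ
  | r + 1, U, W, φ, ψ, k, a => by
    rw [evalMulti_succ, evalMulti_succ, evalMulti_succ, ← evalMulti_add]
    rfl

/-- `evalMulti` of the zero section vanishes. [folklore] -/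
theorem evalMulti_zero_left (r : ℕ) {U W : Y.Opens} (k : W ⟶ U) (a : Fin r → Γ(I, W)) :
    evalMulti I T r (0 : Γ(multiHom I T r, U)) k a = 0 := by
  have h := evalMulti_add I T r (0 : Γ(multiHom I T r, U)) 0 k a
  rw [add_zero] at h
  exact left_eq_add.mp h

/-- `evalMulti` along a restriction of `φ`: `(φ|_V)(a) = φ(a)`. [folklore] -/
theorem evalMulti_map : (r : ℕ) → {U V W : Y.Opens} → (φ : Γ(multiHom I T r, U)) → (l : V ⟶ U) →
    (k : W ⟶ V) → (a : Fin r → Γ(I, W)) →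
    evalMulti I T r ((multiHom I T r).presheaf.map l.op φ) k a = evalMulti I T r φ (k ≫ l) a
  | 0, _, _, _, φ, l, k, _ => presheaf_map_map T l k φ
  | _ + 1, _, _, _, _, _, _, _ => rfl

/-- `evalMulti` is semilinear in `φ`: `(f • φ)(a) = f|_W • φ(a)`. [folklore] -/
theorem evalMulti_smul : (r : ℕ) → {U W : Y.Opens} → (f : Γ(Y, U)) → (φ : Γ(multiHom I T r, U)) →
    (k : W ⟶ U) → (a : Fin r → Γ(I, W)) →
    evalMulti I T r (f • φ) k a = Y.presheaf.map k.op f • evalMulti I T r φ k a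
  | 0, _, _, f, φ, k, _ => Scheme.Modules.map_smul T k f φ
  | r + 1, U, W, f, φ, k, a => by
    rw [evalMulti_succ, evalMulti_succ]
    change evalMulti I T r (Y.presheaf.map k.op f •
        appLE (multiHomSucc I T r φ) k (a (Fin.last r))) (𝟙 W) (Fin.init a) = _
    rw [evalMulti_smul r, op_id, Y.presheaf.map_id]
    rfl

/-- **Naturality of `evalMulti` in `W`**: `φ(a)|_{W'} = φ(a|_{W'})`. [folklore] -/
theorem map_evalMulti : (r : ℕ) → {U W W' : Y.Opens} → (φ : Γ(multiHom I T r, U)) → (k : W ⟶ U) →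
    (l : W' ⟶ W) → (a : Fin r → Γ(I, W)) →
    T.presheaf.map l.op (evalMulti I T r φ k a) =
      evalMulti I T r φ (l ≫ k) (fun s => I.presheaf.map l.op (a s))
  | 0, _, _, _, φ, k, l, _ => presheaf_map_map T k l φ
  | r + 1, U, W, W', φ, k, l, a => by
    rw [evalMulti_succ, evalMulti_succ, map_evalMulti r, appLE_map, evalMulti_map,
      Category.comp_id, Category.id_comp]
    rfl

/-- A section `φ` of `multiHom I T r` over `U` is **alternating** if `φ(a) = 0` for every tuple
`a` of sections of `I` (over any `W ≤ U`) with two equal entries. [folklore] -/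
def IsAltSection (r : ℕ) (U : Y.Opens) (φ : Γ(multiHom I T r, U)) : Prop :=
  ∀ ⦃W : Y.Opens⦄ (k : W ⟶ U) (a : Fin r → Γ(I, W)) (s t : Fin r), s ≠ t → a s = a t →
    evalMulti I T r φ k a = 0

variable {I T} in
/-- Alternating sections restrict to alternating sections. [folklore] -/
theorem IsAltSection.map {r : ℕ} {U V : Y.Opens} {φ : Γ(multiHom I T r, U)}
    (hφ : IsAltSection I T r U φ) (l : V ⟶ U) :
    IsAltSection I T r V ((multiHom I T r).presheaf.map l.op φ) := by
  intro W k a s t hst hat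
  rw [evalMulti_map]
  exact hφ (k ≫ l) a s t hst hat

/-- If `r ≤ 1` every section is alternating (there are no two distinct indices). [folklore] -/
theorem isAltSection_of_le_one {r : ℕ} (hr : r ≤ 1) (U : Y.Opens) (φ : Γ(multiHom I T r, U)) :
    IsAltSection I T r U φ := by
  intro W k a s t hst _
  exact absurd (Fin.ext (by omega)) hst

/-- The alternating sections over `U` form an `𝒪(U)`-submodule. [folklore] -/
def altSubmoduleObj (r : ℕ) (U : Y.Opens) : Submodule Γ(Y, U) Γ(multiHom I T r, U) where
  carrier := {φ | IsAltSection I T r U φ}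
  zero_mem' := fun W k a s t _ _ => evalMulti_zero_left I T r k a
  add_mem' := fun {φ ψ} hφ hψ W k a s t hst hat => by
    rw [evalMulti_add, hφ k a s t hst hat, hψ k a s t hst hat, add_zero]
  smul_mem' := fun f φ hφ W k a s t hst hat => by
    rw [evalMulti_smul, hφ k a s t hst hat, smul_zero]

/-- **The family of alternating sections is stable under restriction** (Mathlib
`PresheafOfModules.Submodule`). [folklore] -/
def altSubmodule (r : ℕ) : PresheafOfModules.Submodule (multiHom I T r).val where
  obj U := altSubmoduleObj I T r U.unop
  map {U V} f := fun φ hφ => by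
    change IsAltSection I T r V.unop ((multiHom I T r).presheaf.map f φ)
    have e : f = f.unop.op := rfl
    rw [e]
    exact IsAltSection.map hφ f.unop

/-- A section which is alternating on the members of an open cover is alternating (the condition
`φ(a) = 0` is local in `W`, by the locality of `T`). [folklore] -/
theorem isAltSection_of_locally {r : ℕ} {ι : Type u} (U : ι → Y.Opens)
    (φ : Γ(multiHom I T r, iSup U))
    (hφ : ∀ i, IsAltSection I T r (U i) ((multiHom I T r).presheaf.map (Opens.leSupr U i).op φ)) :
    IsAltSection I T r (iSup U) φ := by
  intro W k a s t hst hat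
  apply TopCat.Sheaf.eq_of_locally_eq' (⟨T.presheaf, T.isSheaf⟩ : TopCat.Sheaf Ab Y) (fun i => W ⊓ U i) W
    (fun i => Opens.infLELeft W (U i)) (le_iSup_inf k)
  intro i
  rw [map_zero]
  change T.presheaf.map (Opens.infLELeft W (U i)).op (evalMulti I T r φ k a) = 0
  rw [map_evalMulti]
  have e : Opens.infLELeft W (U i) ≫ k = Opens.infLERight W (U i) ≫ Opens.leSupr U i :=
    Subsingleton.elim _ _
  rw [e, ← evalMulti_map]
  exact hφ i (Opens.infLERight W (U i)) _ s t hst (by simp only [hat])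

/-- **The alternating sections form a sheaf.** [folklore] -/
theorem isSheaf_altSubmodule (r : ℕ) :
    TopCat.Presheaf.IsSheaf (altSubmodule I T r).toPresheafOfModules.presheaf := by
  rw [TopCat.Presheaf.isSheaf_iff_isSheafUniqueGluing]
  intro ι U sf hsf
  have hsf' : TopCat.Presheaf.IsCompatible (multiHom I T r).presheaf U fun i => (sf i).val :=
    fun i j => congrArg Subtype.val (hsf i j)
  obtain ⟨φ, hφ, huniq⟩ :=
    (multiHom I T r).isSheaf.isSheafUniqueGluing U (fun i => (sf i).val) hsf'
  have halt : IsAltSection I T r (iSup U) φ :=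
    isAltSection_of_locally I T U φ fun i => by rw [hφ i]; exact (sf i).2
  refine ⟨⟨φ, halt⟩, fun i => Subtype.ext (hφ i), fun t ht => Subtype.ext (huniq t.val fun i => ?_)⟩
  exact congrArg Subtype.val (ht i)

/-- **The subsheaf `𝓐lt_r(I; T) ⊆ multiHom I T r` of alternating iterated homomorphisms**: its
sections over `U` are the alternating `𝒪`-multilinear maps `I|_U × ⋯ × I|_U → T|_U`, i.e.
`𝓐lt_r(I; T) = 𝓗om_{𝒪_Y}(Λʳ I, T)`. [folklore] -/
def altMultiHom (r : ℕ) : Y.Modules :=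
  ⟨(altSubmodule I T r).toPresheafOfModules, isSheaf_altSubmodule I T r⟩

/-- The inclusion `𝓐lt_r(I; T) ⟶ multiHom I T r`. [folklore] -/
def altι (r : ℕ) : altMultiHom I T r ⟶ multiHom I T r :=
  ⟨(altSubmodule I T r).ι⟩

/-- Sections of `altι`: the subtype inclusion (definitionally). [folklore] -/
theorem altι_app_apply (r : ℕ) (U : Y.Opens) (φ : Γ(altMultiHom I T r, U)) :
    (altι I T r).app U φ = (φ : altSubmoduleObj I T r U).val := rfl

/-- Sections of `𝓐lt_r` are alternating. [folklore] -/
theorem isAltSection_altι_app (r : ℕ) (U : Y.Opens) (φ : Γ(altMultiHom I T r, U)) :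
    IsAltSection I T r U ((altι I T r).app U φ) := (φ : altSubmoduleObj I T r U).2

/-- `altι` is injective on sections. [folklore] -/
theorem altι_app_injective (r : ℕ) (U : Y.Opens) : Function.Injective ((altι I T r).app U) :=
  fun _ _ h => Subtype.ext h

/-- `𝓐lt_r ⟶ multiHom I T r` is a monomorphism. [folklore] -/
instance mono_altι (r : ℕ) : Mono (altι I T r) :=
  (Scheme.Modules.toPresheafOfModules Y).mono_of_mono_map
    (inferInstanceAs (Mono (altSubmodule I T r).ι))

/-- **For `r ≤ 1` the inclusion `𝓐lt_r ⟶ multiHom I T r` is an isomorphism** (`𝓐lt₀ = T`,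
`𝓐lt₁ = 𝓗om(I, T)`). [folklore] -/
theorem isIso_altι_of_le_one {r : ℕ} (hr : r ≤ 1) : IsIso (altι I T r) := by
  refine Scheme.Modules.Hom.isIso_iff_isIso_app.mpr fun U => ?_
  rw [ConcreteCategory.isIso_iff_bijective]
  exact ⟨altι_app_injective I T r U, fun φ => ⟨⟨φ, isAltSection_of_le_one I T hr U φ⟩, rfl⟩⟩

/-- An isomorphism of `𝒪_Y`-modules induces a bijection on coherent cohomology. [folklore] -/
theorem moduleSheafCohomology_map_bijective {M N : Y.Modules} (f : M ⟶ N) [IsIso f] (k : ℕ) :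
    Function.Bijective (moduleSheafCohomology.map f k) := by
  let e₀ : M ≅ N := asIso f
  let e : (SheafOfModules.toSheaf Y.ringCatSheaf).obj M ≅ (SheafOfModules.toSheaf Y.ringCatSheaf).obj N :=
    (SheafOfModules.toSheaf Y.ringCatSheaf).mapIso e₀
  change Function.Bijective (Sheaf.H.map e.hom k)
  refine Function.bijective_iff_has_inverse.mpr ⟨Sheaf.H.map e.inv k, fun x => ?_, fun x => ?_⟩
  · rw [← Sheaf.H.map_comp_apply, e.hom_inv_id, Sheaf.H.map_id_apply]
  · rw [← Sheaf.H.map_comp_apply, e.inv_hom_id, Sheaf.H.map_id_apply]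

end Alternating

/-! ### Iterated wedges in an exterior power (pure algebra) -/

section WedgeIter

/-- The degree bookkeeping of the recursion: `pairingDegree r j = j + r`, defined by
`pairingDegree 0 j = j`, `pairingDegree (r + 1) j = pairingDegree r (j + 1)` so that all form
degrees below match DEFINITIONALLY along the recursion. [folklore] -/
def pairingDegree : ℕ → ℕ → ℕ
  | 0, j => j
  | r + 1, j => pairingDegree r (j + 1)

/-- `pairingDegree r j = j + r`. [folklore] -/
theorem pairingDegree_eq : (r j : ℕ) → pairingDegree r j = j + r
  | 0, _ => rfl
  | r + 1, j => (pairingDegree_eq r (j + 1)).trans (Nat.succ_add_eq_add_succ j r)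

variable {A : Type u} [CommRing A] (M : ModuleCat.{u} A)

/-- In the exterior algebra, the left wedge `θ ∧ x` is the product `ι(θ) · x`. [folklore] -/
theorem coe_wedgeLeftHom (n : ℕ) (θ : M) (x : M.exteriorPower n) :
    (wedgeLeftHom M n θ x).val = ExteriorAlgebra.ι A θ * x.val := by
  have h : (⋀[A]^(n + 1) (M : Type u)).subtype ∘ₗ wedgeLeft A n θ =
      LinearMap.mulLeft A (ExteriorAlgebra.ι A θ) ∘ₗ (⋀[A]^n (M : Type u)).subtype := by
    refine exteriorPower.linearMap_ext ?_
    ext m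
    simp only [LinearMap.compAlternatingMap_apply, LinearMap.coe_comp, Function.comp_apply,
      wedgeLeft_ιMulti, Submodule.coe_subtype, exteriorPower.ιMulti_apply_coe,
      LinearMap.mulLeft_apply, ExteriorAlgebra.ιMulti_succ_apply, Matrix.cons_val_zero,
      Matrix.tail_cons]
  exact LinearMap.congr_fun h x

/-- **The iterated wedge** `θ₀ ∧ (θ₁ ∧ ⋯ (θ_{r-1} ∧ ω))`, `ω ∈ Λʲ M`, `θ : Fin r → M`, by the recursion
of the pairing: `wedgeIter (r + 1) j θ ω = wedgeIter r (j + 1) (init θ) (θ_{last} ∧ ω)` (the LAST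
vector is wedged first, innermost). [folklore] -/
def wedgeIter : (r j : ℕ) → (Fin r → M) → M.exteriorPower j → M.exteriorPower (pairingDegree r j)
  | 0, _, _, ω => ω
  | r + 1, j, θ, ω => wedgeIter r (j + 1) (Fin.init θ) (wedgeLeftHom M j (θ (Fin.last r)) ω)

/-- In the exterior algebra, `wedgeIter r j θ ω = ι(θ₀) ⋯ ι(θ_{r-1}) · ω`. [folklore] -/
theorem coe_wedgeIter : (r j : ℕ) → (θ : Fin r → M) → (ω : M.exteriorPower j) →
    (wedgeIter M r j θ ω).val = ExteriorAlgebra.ιMulti A r θ * ω.val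
  | 0, _, θ, ω => by
    rw [ExteriorAlgebra.ιMulti_zero_apply, one_mul]
    rfl
  | r + 1, j, θ, ω => by
    change (wedgeIter M r (j + 1) (Fin.init θ) (wedgeLeftHom M j (θ (Fin.last r)) ω)).val = _
    rw [coe_wedgeIter r (j + 1), coe_wedgeLeftHom, ← mul_assoc, ExteriorAlgebra.ιMulti_apply,
      ExteriorAlgebra.ιMulti_apply, List.ofFn_succ', List.concat_eq_append, List.prod_append,
      List.prod_singleton]
    rfl

/-- **The iterated wedge is alternating in `θ`**: it vanishes when two entries coincide. [folklore] -/
theorem wedgeIter_eq_zero_of_eq (r j : ℕ) (θ : Fin r → M) (ω : M.exteriorPower j) {s t : Fin r}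
    (hst : s ≠ t) (h : θ s = θ t) : wedgeIter M r j θ ω = 0 := by
  apply Subtype.ext
  rw [coe_wedgeIter, ExteriorAlgebra.ιMulti_eq_zero_of_not_inj fun hinj => hst (hinj h), zero_mul]
  rfl

/-- `wedgeIter` is compatible with the maps of exterior powers induced by a semilinear map (the
restriction maps of the presheaf of forms). [folklore] -/
theorem exteriorPowerMap'_wedgeIter {B : Type u} [CommRing B] {φ : A →+* B} {N : ModuleCat.{u} B}
    (g : M ⟶ (ModuleCat.restrictScalars φ).obj N) : (r j : ℕ) → (θ : Fin r → M) →
    (ω : M.exteriorPower j) →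
    exteriorPowerMap' g (pairingDegree r j) (wedgeIter M r j θ ω) =
      wedgeIter N r j (fun s => (g (θ s) : N)) (exteriorPowerMap' g j ω)
  | 0, _, _, _ => rfl
  | r + 1, j, θ, ω => by
    change exteriorPowerMap' g (pairingDegree r (j + 1))
        (wedgeIter M r (j + 1) (Fin.init θ) (wedgeLeftHom M j (θ (Fin.last r)) ω)) =
      wedgeIter N r (j + 1) (Fin.init fun s => (g (θ s) : N))
        (wedgeLeftHom N j (g (θ (Fin.last r)) : N) (exteriorPowerMap' g j ω))
    rw [exteriorPowerMap'_wedgeIter g r (j + 1), exteriorPowerMap'_wedgeLeftHom]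
    rfl

end WedgeIter

/-! ### The recursion: Bloch's pairing `Ωʲ → 𝓗om(𝓘, … 𝓗om(𝓘, Ωⁿ_X|_Z)…)` -/

section Pairing

variable {S : Type u} [CommRing S] {X : Over (Spec (CommRingCat.of S))} {Z : Scheme.{u}}
  (i : Z ⟶ X.left)

/-- **`Ωⁿ_X|_Z` as an `𝒪_X`-module**: the direct image `i_* i^* Ωⁿ_{X/S}` (for `n = dim X` this is
`ω_X ⊗ 𝒪_Z = ω_X|_Z`, the sheaf `ω_X ⊗ 𝒪_Z` of BF (8.1)). [cite: BuchweitzFlenner2003, (8.1)] -/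
def formsOnSubscheme (n : ℕ) : X.left.Modules :=
  (Scheme.Modules.pushforward i).obj ((Scheme.Modules.pullback i).obj (hodgeSheaf X n))

/-- **Restriction of `n`-forms to `Z`**: the unit `Ωⁿ_X → i_* i^* Ωⁿ_X` of the adjunction `i^* ⊣ i_*`
(Mathlib `Scheme.Modules.pullbackPushforwardAdjunction`). [folklore] -/
def restrictForms (n : ℕ) : hodgeSheaf X n ⟶ formsOnSubscheme i n :=
  (Scheme.Modules.pullbackPushforwardAdjunction i).unit.app (hodgeSheaf X n)

/-- The ideal of `Z` kills `i_* i^* Ωⁿ_X`. [folklore] -/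
theorem isKilledBySections_formsOnSubscheme (n : ℕ) :
    IsKilledBySections (idealModule i) (idealModuleι i) (formsOnSubscheme i n) :=
  isKilledBySections_pushforward i _

/-- The target of the curried pairing with `r` conormal slots on `j`-forms:
`𝓗om(𝓘, 𝓗om(𝓘, …, 𝓗om(𝓘, Ω^{j+r}_X|_Z)…))`. [cite: BuchweitzFlenner2003, (8.1)] -/
abbrev pairingTarget (r j : ℕ) : X.left.Modules :=
  multiHom (idealModule i) (formsOnSubscheme i (pairingDegree r j)) r

/-- **Bloch's pairing, curried** (BF (8.1)): the morphism of `𝒪_X`-modules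
`Ωʲ_X → 𝓗om(𝓘, 𝓗om(𝓘, …, 𝓗om(𝓘, Ω^{j+r}_X|_Z)…))` (`r` copies of the ideal `𝓘` of `Z`),
`α ↦ (a_{r-1} ↦ ⋯ (a₀ ↦ (da₀ ∧ ⋯ ∧ da_{r-1} ∧ α)|_Z))` — i.e. the pairing
`Ω^{m+1}_X × Λ^{q-1}𝒩^∨_{Z/X} → ω_X ⊗ 𝒪_Z`, `(α, ν) ↦ α ∧ Λ^{q-1} d̄(ν)` of BF (8.1) for `j = m + 1`,
`r = q - 1`, `j + r = n = dim X` (up to the order of the factors, a sign), written on `X` with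
`𝒩^∨ = 𝓘/𝓘²` replaced by `𝓘` (the values are killed by `𝓘`). Defined by recursion on `r`: for
`r = 0` it is the restriction `Ωʲ_X → Ωʲ_X|_Z`, and the step is `stepHom`.
[cite: BuchweitzFlenner2003, (8.1) (the pairing Ω^{m+1}_X × Λ^{q-1}N^∨ → ω_X ⊗ O_Z)] -/
def blochPairingSheafHom : (r j : ℕ) → (hodgeSheaf X j ⟶ pairingTarget i r j)
  | 0, j => restrictForms i j
  | r + 1, j =>
    stepHom (idealModule i) (idealModuleι i) (blochPairingSheafHom r (j + 1))
      ((isKilledBySections_formsOnSubscheme i _).multiHom r)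

variable {i} in
/-- **The key unfolding**: on (the image in `Ωʲ` of) a presheaf-level form `ω ∈ Λʲ Γ(U, Ω¹)`, one step
of the pairing wedges with `d(ι a)` at the presheaf level and applies the previous pairing:
`ρ_{r+1}(ω)(a) = ρ_r(d(ι a) ∧ ω|_W)`. [folklore] -/
theorem appLE_blochPairingSheafHom_succ_app (r j : ℕ) {U W : X.left.Opens}
    (ω : (formsPresheaf X j).obj (op U)) (k : W ⟶ U) (a : Γ(idealModule i, W)) :
    appLE (multiHomSucc (idealModule i) (formsOnSubscheme i (pairingDegree (r + 1) j)) r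
        ((blochPairingSheafHom i (r + 1) j).app U ((toHodgeSheaf X j).app (op U) ω))) k a =
      (blochPairingSheafHom i r (j + 1)).app W ((toHodgeSheaf X (j + 1)).app (op W)
        (wedgeLeftHom ((formsOne X).obj (op W)) j (dIdeal (idealModule i) (idealModuleι i) W a)
          ((formsPresheaf X j).map k.op ω))) := by
  change (blochPairingSheafHom i r (j + 1)).app W
    (appLE ((wedgeSheafHom X j).val.app (op U) ((toHodgeSheaf X j).app (op U) ω)) k
      (dIdeal (idealModule i) (idealModuleι i) W a)) = _
  rw [wedgeSheafHom_app_toHodgeSheaf, appLE_wedgeHom]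
  rfl

variable {i} in
/-- **The pairing on presheaf-level forms, evaluated**: for `ω ∈ Λʲ Γ(U, Ω¹)` and a tuple `a` of
sections of `𝓘` over `W ≤ U`,
`ρ_r(ω)(a) = (dι(a₀) ∧ ⋯ ∧ dι(a_{r-1}) ∧ ω|_W)|_Z` (`wedgeIter`, pushed into `Ω^{j+r}` and restricted
to `Z`). [cite: BuchweitzFlenner2003, (8.1)] -/
theorem evalMulti_blochPairingSheafHom_app : (r j : ℕ) → {U W : X.left.Opens} →
    (ω : (formsPresheaf X j).obj (op U)) → (k : W ⟶ U) → (a : Fin r → Γ(idealModule i, W)) →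
    evalMulti (idealModule i) (formsOnSubscheme i (pairingDegree r j)) r
        ((blochPairingSheafHom i r j).app U ((toHodgeSheaf X j).app (op U) ω)) k a =
      (restrictForms i (pairingDegree r j)).app W ((toHodgeSheaf X (pairingDegree r j)).app (op W)
        (wedgeIter ((formsOne X).obj (op W)) r j
          (fun s => dIdeal (idealModule i) (idealModuleι i) W (a s)) ((formsPresheaf X j).map k.op ω)))
  | 0, j, U, W, ω, k, _ => by
    change (formsOnSubscheme i j).presheaf.map k.op ((restrictForms i j).app U _) =
      (restrictForms i j).app W ((toHodgeSheaf X j).app (op W) ((formsPresheaf X j).map k.op ω))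
    rw [PresheafOfModules.naturality_apply (toHodgeSheaf X j) k.op ω]
    exact (PresheafOfModules.naturality_apply (restrictForms i j).val k.op _).symm
  | r + 1, j, U, W, ω, k, a => by
    rw [evalMulti_succ, appLE_blochPairingSheafHom_succ_app]
    refine (evalMulti_blochPairingSheafHom_app r (j + 1) _ (𝟙 W) (Fin.init a)).trans ?_
    rw [op_id, presheafOfModules_map_id_apply]
    rfl

variable {i} in
/-- **The pairing is alternating** on (images of) presheaf-level forms. [folklore] -/
theorem isAltSection_blochPairingSheafHom_app (r j : ℕ) (U : X.left.Opens)
    (ω : (formsPresheaf X j).obj (op U)) :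
    IsAltSection (idealModule i) (formsOnSubscheme i (pairingDegree r j)) r U
      ((blochPairingSheafHom i r j).app U ((toHodgeSheaf X j).app (op U) ω)) := by
  intro W k a s t hst hat
  have hz : wedgeIter ((formsOne X).obj (op W)) r j
      (fun s => dIdeal (idealModule i) (idealModuleι i) W (a s)) ((formsPresheaf X j).map k.op ω) =
        (0 : (formsPresheaf X (pairingDegree r j)).obj (op W)) :=
    wedgeIter_eq_zero_of_eq _ r j _ _ hst (by simp only [hat])
  rw [evalMulti_blochPairingSheafHom_app, hz, map_zero]
  exact map_zero _

/-- The pairing precomposed with the sheafification map `Λʲ Γ(–, Ω¹) → Ωʲ`: a morphism of presheaves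
of modules `Λʲ Γ(–, Ω¹) → multiHom 𝓘 (Ω^{j+r}_X|_Z) r` (the image of `blochPairingSheafHom` under the
sheafification adjunction). [folklore] -/
def blochPairingPresheafHom (r j : ℕ) :
    formsPresheaf X j ⟶ (PresheafOfModules.restrictScalars (𝟙 X.left.ringCatSheaf.obj)).obj
      (pairingTarget i r j).val :=
  toHodgeSheaf X j ≫ (PresheafOfModules.restrictScalars (𝟙 X.left.ringCatSheaf.obj)).map
    (blochPairingSheafHom i r j).val

/-- Components of `blochPairingPresheafHom`. [folklore] -/
theorem blochPairingPresheafHom_app_apply (r j : ℕ) (U : (X.left.Opens)ᵒᵖ)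
    (ω : (formsPresheaf X j).obj U) :
    (blochPairingPresheafHom i r j).app U ω =
      (blochPairingSheafHom i r j).app U.unop ((toHodgeSheaf X j).app U ω) := rfl

/-- The pairing on presheaf-level forms, with values in the alternating subsheaf: the morphism of
presheaves of modules `Λʲ Γ(–, Ω¹) → 𝓐lt_r(𝓘; Ω^{j+r}_X|_Z)`. [folklore] -/
def blochPairingAltPresheafHom (r j : ℕ) :
    formsPresheaf X j ⟶ (PresheafOfModules.restrictScalars (𝟙 X.left.ringCatSheaf.obj)).obj
      (altMultiHom (idealModule i) (formsOnSubscheme i (pairingDegree r j)) r).val :=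
  PresheafOfModules.homMk
    { app := fun U => AddCommGrpCat.ofHom
        (((blochPairingPresheafHom i r j).app U).hom.toAddMonoidHom.codRestrict
          (altSubmoduleObj (idealModule i) (formsOnSubscheme i (pairingDegree r j)) r U.unop)
          (fun ω => isAltSection_blochPairingSheafHom_app r j U.unop ω))
      naturality := fun {U V} l => by
        refine AddCommGrpCat.ext fun ω => Subtype.ext ?_
        exact PresheafOfModules.naturality_apply (blochPairingPresheafHom i r j) l ω }
    (fun U f ω => Subtype.ext (((blochPairingPresheafHom i r j).app U).hom.map_smul f ω))

/-- After the inclusion `𝓐lt ⟶ multiHom`, `blochPairingAltPresheafHom` is `blochPairingPresheafHom`.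
[folklore] -/
theorem blochPairingAltPresheafHom_comp (r j : ℕ) :
    blochPairingAltPresheafHom i r j ≫
        (PresheafOfModules.restrictScalars (𝟙 X.left.ringCatSheaf.obj)).map
          (altι (idealModule i) (formsOnSubscheme i (pairingDegree r j)) r).val =
      blochPairingPresheafHom i r j := by
  refine PresheafOfModules.hom_ext fun U => ?_
  ext ω
  rfl

/-- **Bloch's pairing with values in the alternating subsheaf**
`Ωʲ_X → 𝓐lt_r(𝓘; Ω^{j+r}_X|_Z) = 𝓗om(Λʳ𝓘, Ω^{j+r}_X|_Z)` (`= i_* 𝓗om_{𝒪_Z}(Λʳ(𝓘/𝓘²), ω_X|_Z)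
= i_*(Λʳ𝒩_{Z/X} ⊗ ω_X|_Z) ≅ i_*(𝒩^∨_{Z/X} ⊗ ω_Z)` for `Z` a local complete intersection of
codimension `q = r + 1` and `j + r = dim X`, BF (8.1) (1)), obtained from `blochPairingAltPresheafHom`
by the sheafification adjunction. [cite: BuchweitzFlenner2003, (8.1) (1)] -/
def blochPairingAltSheafHom (r j : ℕ) :
    hodgeSheaf X j ⟶ altMultiHom (idealModule i) (formsOnSubscheme i (pairingDegree r j)) r :=
  ((PresheafOfModules.sheafificationAdjunction (𝟙 X.left.ringCatSheaf.obj)).homEquiv _ _).symm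
    (blochPairingAltPresheafHom i r j)

/-- **The pairing factors through the alternating subsheaf**:
`blochPairingAltSheafHom ≫ altι = blochPairingSheafHom`. [folklore] -/
theorem blochPairingAltSheafHom_comp_altι (r j : ℕ) :
    blochPairingAltSheafHom i r j ≫ altι (idealModule i) (formsOnSubscheme i (pairingDegree r j)) r =
      blochPairingSheafHom i r j := by
  have h := (PresheafOfModules.sheafificationAdjunction
    (𝟙 X.left.ringCatSheaf.obj)).homEquiv_naturality_right_symm (blochPairingAltPresheafHom i r j)
      (altι (idealModule i) (formsOnSubscheme i (pairingDegree r j)) r)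
  refine h.symm.trans ?_
  rw [Equiv.symm_apply_eq]
  exact blochPairingAltPresheafHom_comp i r j

end Pairing

/-! ### Cohomology: the Bloch pairing map and Bloch semiregularity -/

section Cohomology

variable {S : Type u} [CommRing S] {X : Over (Spec (CommRingCat.of S))} {Z : Scheme.{u}}
  (i : Z ⟶ X.left)

/-- **Bloch's pairing in cohomology** (the map which BF DUALIZE to define Bloch's semiregularity map,
(8.1) (2)): `Hᵏ(X, Ωʲ_X) → Hᵏ(X, 𝓐lt_r(𝓘; Ω^{j+r}_X|_Z))`, induced by `blochPairingAltSheafHom`.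
For `X` smooth of dimension `n = j + r = m + q` and `Z` a local complete intersection of codimension
`q = r + 1` (so `j = m + 1`, `m = dim Z`) the target is BF's
`Hᵏ(Z, 𝓗om(Λ^{q-1}(𝓘/𝓘²), ω_X|_Z)) = Hᵏ(Z, Λ^{q-1}𝒩_{Z/X} ⊗ ω_X) ≅ Hᵏ(Z, 𝒩^∨_{Z/X} ⊗ ω_Z)`
and, for `k = m - k'`, its transpose under Serre duality (on `X` and on `Z`) is
`τ_B : H^{k'}(Z, 𝒩_{Z/X}) → H^{q+k'}(X, Ω^{q-1}_X)`; "Bloch's semiregularity map is just this map for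
`k' = 1`". [cite: BuchweitzFlenner2003, (8.1) (1)-(2)] -/
def blochPairingMap (r j k : ℕ) :
    hodgeCohomology X j k →+
      moduleSheafCohomology (altMultiHom (idealModule i) (formsOnSubscheme i (pairingDegree r j)) r) k :=
  moduleSheafCohomology.map (blochPairingAltSheafHom i r j) k

/-- The same map with values in the full iterated Hom `Hᵏ(X, multiHom 𝓘 (Ω^{j+r}_X|_Z) r)` (for
`r ≤ 1`, i.e. codimension `≤ 2`, the two targets coincide: `isIso_altι_of_le_one`). [folklore] -/
def blochPairingMapMultiHom (r j k : ℕ) :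
    hodgeCohomology X j k →+ moduleSheafCohomology (pairingTarget i r j) k :=
  moduleSheafCohomology.map (blochPairingSheafHom i r j) k

/-- `blochPairingMapMultiHom = H(altι) ∘ blochPairingMap`. [folklore] -/
theorem blochPairingMapMultiHom_apply (r j k : ℕ) (x : hodgeCohomology X j k) :
    blochPairingMapMultiHom i r j k x =
      moduleSheafCohomology.map (altι (idealModule i) (formsOnSubscheme i (pairingDegree r j)) r) k
        (blochPairingMap i r j k x) := by
  have h : (SheafOfModules.toSheaf X.left.ringCatSheaf).map (blochPairingSheafHom i r j) =
      (SheafOfModules.toSheaf X.left.ringCatSheaf).map (blochPairingAltSheafHom i r j) ≫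
        (SheafOfModules.toSheaf X.left.ringCatSheaf).map
          (altι (idealModule i) (formsOnSubscheme i (pairingDegree r j)) r) := by
    rw [← blochPairingAltSheafHom_comp_altι i r j]
    exact Functor.map_comp _ _ _
  change Sheaf.H.map _ k x = Sheaf.H.map _ k (Sheaf.H.map _ k x)
  rw [← Sheaf.H.map_comp_apply, ← h]

/-- For `r ≤ 1` (codimension `≤ 2`), surjectivity onto the alternating target is surjectivity onto
the full iterated Hom. [folklore] -/
theorem surjective_blochPairingMap_iff_of_le_one {r : ℕ} (hr : r ≤ 1) (j k : ℕ) :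
    Function.Surjective (blochPairingMap i r j k) ↔
      Function.Surjective (blochPairingMapMultiHom i r j k) := by
  haveI := isIso_altι_of_le_one (idealModule i) (formsOnSubscheme i (pairingDegree r j)) hr
  have hbij := moduleSheafCohomology_map_bijective
    (altι (idealModule i) (formsOnSubscheme i (pairingDegree r j)) r) k
  have hcomp : (blochPairingMapMultiHom i r j k : hodgeCohomology X j k → _) =
      moduleSheafCohomology.map (altι (idealModule i) (formsOnSubscheme i (pairingDegree r j)) r) k ∘
        blochPairingMap i r j k :=
    funext (blochPairingMapMultiHom_apply i r j k)
  rw [hcomp]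
  exact ⟨fun h => hbij.2.comp h, fun h => Function.Surjective.of_comp_left h hbij.1⟩

/-- **`Z ⊆ X` is semiregular in the sense of Bloch** — for `X` (intended: smooth and proper over a
field, of pure dimension `n`) and `i : Z → X` (intended: the closed immersion of a local complete
intersection of pure codimension `p`): for `r + 1 = p`, `m + p = n` (`m = dim Z`) and `k + 1 = m`,
the Bloch pairing map
`H^{m-1}(X, Ω^{m+1}_X) → H^{m-1}(X, 𝓐lt_{p-1}(𝓘; Ωⁿ_X|_Z)) = H^{m-1}(Z, Λ^{p-1}𝒩 ⊗ ω_X|_Z) ≅ H^{m-1}(Z, 𝒩^∨ ⊗ ω_Z)`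
is SURJECTIVE. By BF (8.1) (2) Bloch's semiregularity map
`π_Z = τ_B : H¹(Z, 𝒩_{Z/X}) → H^{p+1}(X, Ω^{p-1}_X)` is, by DEFINITION there, the transpose
(Serre dual) of this map, so by finite-dimensional duality this is INJECTIVITY OF BLOCH'S MAP, i.e.
semiregularity of `Z` in the sense of Bloch (BF §1: "S. Bloch … was able to define … for every
locally complete intersection `Z` of codimension `q` in `X` a semiregularity map
`τ : H¹(Z, 𝒩_{Z/X}) → H^{q+1}(X, Ω^{q-1}_X)` to show again that the injectivity of `τ` implies that
`[Z]` is a smooth point of `H_X`. His semiregularity map admits a simple description using Serre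
duality"); for `p = 1` it is literally Severi's definition ("the restriction map
`H⁰(X, ω_X) → H⁰(Z, ω_X|Z)` is surjective or, dually, that the semiregularity map
`H¹(Z, 𝒩_{Z/X}) → H²(X, 𝒪_X)` is injective", here in degree `m - 1 = n - 2`). The degenerate cases
`p = 0`, `p > n`, `dim Z = 0` are vacuous (as they should: there `H¹(Z, 𝒩) → H^{p+1}(X, Ω^{p-1})`
is injective for trivial reasons). Unfoldings: `isBlochSemiregular_iff`, `isBlochSemiregular_one_iff`,
`isBlochSemiregular_two_iff`.
[cite: BuchweitzFlenner2003, §1 (Severi; Bloch's τ and Serre duality) and (8.1) (2)]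
[cite: Bloch1972Semiregularity, §4–§6 (cite-only; via BF (8.1)–Prop. 8.2)]
[cite: BandieraLepriManetti2023, §1 (Z is semiregular iff the semiregularity map is injective)] -/
def IsBlochSemiregular (n p : ℕ) : Prop :=
  ∀ r m k : ℕ, r + 1 = p → m + p = n → k + 1 = m →
    Function.Surjective (blochPairingMap i r (m + 1) k)

variable {i} in
/-- Unfolding `IsBlochSemiregular` at given codimension `p = r + 1`, dimension `m = k + 1` of `Z` and
`n = m + p` of `X`: surjectivity of `H^{m-1}(X, Ω^{m+1}_X) → H^{m-1}(X, 𝓐lt_r(𝓘; Ωⁿ_X|_Z))`.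
[cite: BuchweitzFlenner2003, (8.1) (2)] -/
theorem isBlochSemiregular_iff {n p r m k : ℕ} (hp : r + 1 = p) (hn : m + p = n) (hk : k + 1 = m) :
    IsBlochSemiregular i n p ↔ Function.Surjective (blochPairingMap i r (m + 1) k) := by
  refine ⟨fun h => h r m k hp hn hk, fun h r' m' k' hp' hn' hk' => ?_⟩
  obtain rfl : r' = r := by omega
  obtain rfl : m' = m := by omega
  obtain rfl : k' = k := by omega
  exact h

/-- The top form degree in `isBlochSemiregular_iff` is `n = dim X`: `pairingDegree r (m + 1) = n`.
[folklore] -/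
theorem pairingDegree_eq_of {n p r m : ℕ} (hp : r + 1 = p) (hn : m + p = n) :
    pairingDegree r (m + 1) = n := by
  rw [pairingDegree_eq]; omega

/-- A zero-dimensional `Z` (`n = p`) is Bloch-semiregular (`H¹(Z, 𝒩) = 0`; here: vacuously). [folklore] -/
theorem isBlochSemiregular_of_eq (n : ℕ) : IsBlochSemiregular i n n :=
  fun _ _ _ _ _ _ => by omega

/-- **Codimension one (Severi, Kodaira–Spencer)**: a hypersurface `Z ⊆ X` (`dim X = n = m + 1`) is
Bloch-semiregular iff the restriction `H^{m-1}(X, Ωⁿ_X) → H^{m-1}(X, Ωⁿ_X|_Z) = H^{m-1}(Z, ω_X|_Z)`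
is surjective ("the restriction map `H⁰(X, ω_X) → H⁰(Z, ω_X|Z)` is surjective", the case of curves on
surfaces, `m = 1`). [cite: BuchweitzFlenner2003, §1 (Severi's definition)] -/
theorem isBlochSemiregular_one_iff {n m k : ℕ} (hn : m + 1 = n) (hk : k + 1 = m) :
    IsBlochSemiregular i n 1 ↔
      Function.Surjective (moduleSheafCohomology.map (restrictForms i (m + 1)) k :
        hodgeCohomology X (m + 1) k → moduleSheafCohomology (formsOnSubscheme i (m + 1)) k) := by
  rw [isBlochSemiregular_iff (r := 0) rfl hn hk, surjective_blochPairingMap_iff_of_le_one i zero_le_one]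
  rfl

/-- **Codimension two** (the case of surfaces in fourfolds, `n = 4`, `p = 2`): `Z` is
Bloch-semiregular iff
`H^{m-1}(X, Ω^{m+1}_X) → H^{m-1}(X, 𝓗om(𝓘, Ω^{m+2}_X|_Z)) = H^{m-1}(Z, 𝒩 ⊗ ω_X|_Z)`,
`α ↦ (a ↦ (da ∧ α)|_Z)`, is surjective. [cite: BuchweitzFlenner2003, (8.1) (1)-(2)] -/
theorem isBlochSemiregular_two_iff {n m k : ℕ} (hn : m + 2 = n) (hk : k + 1 = m) :
    IsBlochSemiregular i n 2 ↔ Function.Surjective (blochPairingMapMultiHom i 1 (m + 1) k) := by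
  rw [isBlochSemiregular_iff (r := 1) rfl hn hk, surjective_blochPairingMap_iff_of_le_one i le_rfl]

end Cohomology

/-! ### The normal sheaf and `H¹(Z, 𝒩_{Z/X})` (the source of Bloch's map) -/

section Normal

variable {Y Z : Scheme.{u}} (i : Z ⟶ Y)

/-- **The normal sheaf** `𝒩_{Z/Y} = (i^*𝓘)^∨ = 𝓗om_{𝒪_Z}(𝓘/𝓘², 𝒪_Z)` of `i : Z → Y` (BF §1:
"`𝒩_{Z/X} = 𝓗om_X(𝒥, 𝒪_Z)` denotes the normal sheaf of `Z` in `X`"; (8.1): "`𝒩_{Z/X} ≅ (𝒥/𝒥²)^∨ :=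
𝓗om_{𝒪_Z}(𝒥/𝒥², 𝒪_Z)` is the normal bundle of `Z` in `X`" for `Z` a local complete intersection),
on real carriers: the dual (`Modules.dual`) of the conormal sheaf `Deformation.conormalSheaf i = i^*𝓘`.
[cite: BuchweitzFlenner2003, §1 and (8.1)] -/
def normalSheaf : Z.Modules :=
  dual (conormalSheaf i)

/-- **The cohomology `Hᵏ(Z, 𝒩_{Z/Y})` of the normal sheaf** (`k = 0`: the tangent space of the Hilbert
scheme / Douady space at `[Z]`; `k = 1`: the source of Bloch's semiregularity map, containing the
obstructions to embedded deformations of a local complete intersection `Z`).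
[cite: BuchweitzFlenner2003, §1] -/
abbrev normalSheafCohomology (k : ℕ) : Type u :=
  moduleSheafCohomology (normalSheaf i) k

end Normal

end Literature.AlgebraicGeometry.HodgeTheory

end
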